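import Summits.QuantumFields.BalabanUV.Beta.GAN24.FibreArrowBZ
import Summits.QuantumFields.BalabanUV.Beta.GAN24.AliasWeightsSum
import Summits.QuantumFields.BalabanUV.Beta.GAN24.SymbolTaylor
import Literature.MathematicalPhysics.QuantumLattice.TorusTestPotential

/-!
# `BalabanUV.Beta.GAN24.GoodAliasStrip` — binder row G-an2-4 / (CONV-C), road P1-fibre (toward p1's L10, (U1)): on a COMPLEX STRIP `|Im p| ≤ κ` of `j`-UNIFORM width
# every GOOD alias stays off the zero mode — `Re L_m(p) ≥ (4 − 2Dκ²)/N²` for `m ≠ 0` — so the enlarged capacitance system of `GAN24/EnlargedCapacitance` is available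
# on the WHOLE strip (its only hypothesis `hL′` discharged), uniformly in `N`

NOT IN PRINT; OUR PROOF ATTEMPT.  HONEST FRAMING (cell contract, verbatim): «discharging `BetaPertH` makes Bałaban's UV stability UNCONDITIONAL — a real
constructive-QFT result; it is NOT the continuum limit and NOT the Clay problem.»  HONEST DEPENDENCY (verbatim): «continuum YM on T⁴ ⇐ BetaPertH ∧ nine spine
estimates (0/9 proved); BetaPertH ⇐ (D1) ∧ (D4) ∧ CAP+tail; G-an2-4 gates asym, D1 and NE2/3/4.»  [folklore] elementary complex trigonometry (no cited fact, no wall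
binder, no `def`).  NOT summit progress; nothing of (CONV-C)'s K-slot is discharged here.

## What is proved (generic `D`, `N ≥ 1`)
* §1 THE SHIFTED SYMBOL: `Re (∂̂_κ(k)·∂̂♭_κ(k)) = 2 − 2·cosh(Im k_κ)·cos(Re k_κ)` (`re_dhat_mul_dflat`) — the first-order effect of an imaginary shift is purely
  imaginary («antisymmetric»), the real part moves only at second order: `Re (∂̂∂̂♭)(k) ≥ 4 sin²(Re k_κ/2) − 2(cosh(Im k_κ) − 1)` (`re_dhat_mul_dflat_ge`),
  `cosh b − 1 ≤ b²` for `|b| ≤ 1` (the tree's `QuantumLattice.cosh_sub_one_le_sq_of_abs_le_one`, BY NAME), hence `Re L(k) ≥ lapR (Re k) − 2·Σ_κ (Im k_κ)²` (`re_lapSym_ge`).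
* §2 ON THE STRIP `B4Strip.Strip D κ` (`|Re p_μ| ≤ π`, `|Im p_μ| ≤ κ`), `κ ≤ 1`: `Re (kFine p m) = kfine N (reVec p) m`, `Im (kFine p m κ) = Im p_κ / N`, so
  `Re L_m(p) ≥ lapR (kfine N (reVec p) m) − 2Dκ²/N²` (`re_lapSym_kFine_ge`), and for `m ≠ 0` (L06's `four_le_sq_mul_lapR`: `N²·lapR ≥ 4`):
  **`re_lapSym_kFine_ge_of_ne_zero`**: `Re L_m(p) ≥ (4 − 2Dκ²)/N²`, **`lapSym_kFine_ne_zero_of_strip`** (`2Dκ² < 4`), `norm_lapSym_kFine_ge_of_strip`.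
* §3 **`hL'_of_strip`**: the hypothesis `hL′ : ∀ m ≠ 0, L_m(p) ≠ 0` of `EnlargedCapacitance.goodFibre`/`fibreFun_eq_iff_enlSolves`/
  `det_fibreMatrix_ne_zero_of_enl_injective` holds at EVERY `p ∈ Strip D κ` once `κ ≤ 1 ∧ 2Dκ² < 4` (e.g. `κ = 1/2` at `D = 4`) — UNIFORMLY IN `N`: on such a strip
  the zero alias `m = 0` is the ONLY obstruction to the closed form, as the journal STRUCTURE NOTE (leaf-06, 2026-08-20) asserted.
Unit `b2b-balaban-gan24-formalise-leaf-06` (G-an2-4 formalisation swarm), 2026-08-20.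
-/

noncomputable section

open Complex Finset
open scoped BigOperators Real
open Literature.MathematicalPhysics.QuantumFieldTheory.Balaban1983to89
open Literature.MathematicalPhysics.QuantumFieldTheory.Balaban1983to89.Beta
open Literature.MathematicalPhysics.QuantumFieldTheory.LatticeForm (repZ)
open Literature.Probability.LatticeModels (TorusSite)
open B4Strip (Strip reVec)
open Summit.QuantumFields.BalabanUV.Beta.GAN24.FibreSymbols (dhat dflat lapSym)
open Summit.QuantumFields.BalabanUV.Beta.GAN24.FibreDFT (kFine)
open Summit.QuantumFields.BalabanUV.Beta.GAN24.AliasWeights (kfine)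
open Summit.QuantumFields.BalabanUV.Beta.GAN24.AliasWeightsSum (lapR four_le_sq_mul_lapR)

namespace Summit.QuantumFields.BalabanUV.Beta.GAN24.GoodAliasStrip

variable {D N : ℕ}

/-! ## §1 The symbol at a complex momentum: real part -/

/-- [folklore] `Re (∂̂_κ(k) ∂̂♭_κ(k)) = 2 − 2 cosh(Im k_κ) cos(Re k_κ)`. -/
theorem re_dhat_mul_dflat (k : Fin D → ℂ) (κ : Fin D) :
    (dhat k κ * dflat k κ).re = 2 - 2 * Real.cosh (k κ).im * Real.cos (k κ).re := by
  have h1 : cexp (I * k κ) = Complex.exp ⟨-(k κ).im, (k κ).re⟩ := by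
    congr 1; apply Complex.ext <;> simp
  have h2 : cexp (-(I * k κ)) = Complex.exp ⟨(k κ).im, -(k κ).re⟩ := by
    congr 1; apply Complex.ext <;> simp
  simp only [dhat, dflat, h1, h2, Complex.sub_re, Complex.sub_im, Complex.mul_re, Complex.exp_re, Complex.exp_im, Complex.one_re,
    Complex.one_im, Real.cos_neg, Real.sin_neg, Real.cosh_eq]
  have h3 : Real.exp (-(k κ).im) * Real.exp (k κ).im = 1 := by rw [← Real.exp_add]; simp
  nlinarith [Real.sin_sq_add_cos_sq (k κ).re, h3]

/-- [folklore] `Re (∂̂∂̂♭)_κ(k) ≥ 4 sin²(Re k_κ/2) − 2(cosh(Im k_κ) − 1)` — the imaginary shift costs only second order in the real part. -/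
theorem re_dhat_mul_dflat_ge (k : Fin D → ℂ) (κ : Fin D) :
    4 * Real.sin ((k κ).re / 2) ^ 2 - 2 * (Real.cosh (k κ).im - 1) ≤ (dhat k κ * dflat k κ).re := by
  rw [re_dhat_mul_dflat, SymbolTaylor.four_sin_sq_half_eq]
  have hc : Real.cos (k κ).re ≤ 1 := Real.cos_le_one _
  have hch : 1 ≤ Real.cosh (k κ).im := Real.one_le_cosh _
  nlinarith

/-- [folklore] `Re L(k) ≥ lapR (Re k) − 2 Σ_κ (Im k_κ)²` whenever `|Im k_κ| ≤ 1`. -/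
theorem re_lapSym_ge (k : Fin D → ℂ) (hk : ∀ κ, |(k κ).im| ≤ 1) :
    lapR (fun κ => (k κ).re) - 2 * ∑ κ, (k κ).im ^ 2 ≤ (lapSym k).re := by
  unfold lapSym lapR
  rw [Complex.re_sum, Finset.mul_sum, ← Finset.sum_sub_distrib]
  refine Finset.sum_le_sum fun κ _ => ?_
  have h1 := re_dhat_mul_dflat_ge k κ
  have h2 := Literature.MathematicalPhysics.QuantumLattice.cosh_sub_one_le_sq_of_abs_le_one (hk κ)
  linarith

/-! ## §2 On the strip -/

/-- [folklore] Real part of the fine momentum: `Re (kFine p m) = kfine N (reVec p) m`. -/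
theorem re_kFine [NeZero N] (p : Fin D → ℂ) (m : TorusSite D N) (κ : Fin D) : (kFine p m κ).re = kfine N (reVec p) m κ := by
  simp [kFine, kfine, reVec, repZ, Complex.div_natCast_re, -ZMod.natCast_val]

/-- [folklore] Imaginary part of the fine momentum: `Im (kFine p m κ) = Im p_κ / N`. -/
theorem im_kFine [NeZero N] (p : Fin D → ℂ) (m : TorusSite D N) (κ : Fin D) : (kFine p m κ).im = (p κ).im / N := by
  simp [kFine, repZ, Complex.div_natCast_im, -ZMod.natCast_val]

/-- [folklore] The real parts as a vector: `(fun κ => Re (kFine p m κ)) = kfine N (reVec p) m`. -/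
theorem re_kFine_eq [NeZero N] (p : Fin D → ℂ) (m : TorusSite D N) : (fun κ => (kFine p m κ).re) = kfine N (reVec p) m :=
  funext fun κ => re_kFine p m κ

/-- [folklore] **ON THE STRIP**: `Re L_m(p) ≥ lapR (kfine N (reVec p) m) − 2Dκ²/N²` for `p ∈ Strip D κ`, `0 ≤ κ ≤ 1`. -/
theorem re_lapSym_kFine_ge [NeZero N] {κc : ℝ} (hκ1 : κc ≤ 1) {p : Fin D → ℂ} (hp : p ∈ Strip D κc) (m : TorusSite D N) :
    lapR (kfine N (reVec p) m) - 2 * (D * (κc / N) ^ 2) ≤ (lapSym (kFine p m)).re := by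
  have hN : (1 : ℝ) ≤ N := by exact_mod_cast Nat.one_le_iff_ne_zero.mpr (NeZero.ne N)
  have hN0 : (0 : ℝ) < N := by linarith
  have him : ∀ κ, |(kFine p m κ).im| ≤ κc / N := by
    intro κ
    rw [im_kFine, abs_div, abs_of_pos hN0]
    exact div_le_div_of_nonneg_right (hp κ).2 hN0.le
  have him1 : ∀ κ, |(kFine p m κ).im| ≤ 1 := fun κ =>
    (him κ).trans ((div_le_one hN0).mpr (hκ1.trans hN))
  have h := re_lapSym_ge (kFine p m) him1
  rw [re_kFine_eq] at h
  have hsum : ∑ κ : Fin D, (kFine p m κ).im ^ 2 ≤ D * (κc / N) ^ 2 := by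
    calc ∑ κ : Fin D, (kFine p m κ).im ^ 2 ≤ ∑ _κ : Fin D, (κc / N) ^ 2 :=
          Finset.sum_le_sum fun κ _ => by
            have := him κ
            rw [← sq_abs]
            exact pow_le_pow_left₀ (abs_nonneg _) this 2
      _ = D * (κc / N) ^ 2 := by rw [Finset.sum_const, Finset.card_univ, Fintype.card_fin, nsmul_eq_mul]
  linarith

/-- [folklore] **GOOD ALIASES ON THE STRIP**: for `m ≠ 0`, `Re L_m(p) ≥ (4 − 2Dκ²)/N²` (L06's `four_le_sq_mul_lapR` at the real part + §1). -/
theorem re_lapSym_kFine_ge_of_ne_zero [NeZero N] {κc : ℝ} (hκ1 : κc ≤ 1) {p : Fin D → ℂ} (hp : p ∈ Strip D κc)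
    {m : TorusSite D N} (hm : m ≠ 0) : (4 - 2 * D * κc ^ 2) / (N : ℝ) ^ 2 ≤ (lapSym (kFine p m)).re := by
  have hN0 : (0 : ℝ) < N := by exact_mod_cast Nat.pos_of_ne_zero (NeZero.ne N)
  have hre : ∀ i, |reVec p i| ≤ π := fun i => (hp i).1
  have h4 := four_le_sq_mul_lapR (N := N) hre hm
  have h := re_lapSym_kFine_ge hκ1 hp m
  have hdiv : 4 / (N : ℝ) ^ 2 ≤ lapR (kfine N (reVec p) m) := by
    rw [div_le_iff₀ (by positivity)]; linarith
  have : (4 - 2 * D * κc ^ 2) / (N : ℝ) ^ 2 = 4 / (N : ℝ) ^ 2 - 2 * (D * (κc / N) ^ 2) := by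
    field_simp
  rw [this]
  linarith

/-- [folklore] Hence `L_m(p) ≠ 0` for every `m ≠ 0` on every strip with `2Dκ² < 4`, `κ ≤ 1`. -/
theorem lapSym_kFine_ne_zero_of_strip [NeZero N] {κc : ℝ} (hκ1 : κc ≤ 1) (hD : 2 * D * κc ^ 2 < 4)
    {p : Fin D → ℂ} (hp : p ∈ Strip D κc) {m : TorusSite D N} (hm : m ≠ 0) : lapSym (kFine p m) ≠ 0 := by
  intro h0
  have h := re_lapSym_kFine_ge_of_ne_zero hκ1 hp hm
  rw [h0, Complex.zero_re] at h
  have hN0 : (0 : ℝ) < N := by exact_mod_cast Nat.pos_of_ne_zero (NeZero.ne N)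
  have : 0 < (4 - 2 * D * κc ^ 2) / (N : ℝ) ^ 2 := div_pos (by linarith) (by positivity)
  linarith

/-- [folklore] Quantitative form: `‖L_m(p)‖ ≥ (4 − 2Dκ²)/N²` on the strip for `m ≠ 0`. -/
theorem norm_lapSym_kFine_ge_of_strip [NeZero N] {κc : ℝ} (hκ1 : κc ≤ 1) {p : Fin D → ℂ} (hp : p ∈ Strip D κc)
    {m : TorusSite D N} (hm : m ≠ 0) : (4 - 2 * D * κc ^ 2) / (N : ℝ) ^ 2 ≤ ‖lapSym (kFine p m)‖ :=
  (re_lapSym_kFine_ge_of_ne_zero hκ1 hp hm).trans (Complex.re_le_norm _)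

/-! ## §3 The hypothesis of the enlarged capacitance system, on the whole strip -/

/-- [folklore] **`hL′` ON THE STRIP**: at every `p ∈ Strip D κ` with `0 ≤ κ ≤ 1`, `2Dκ² < 4`, every good alias is off the zero mode — uniformly in `N`.
This is the (only) hypothesis of `EnlargedCapacitance.goodFibre`/`fibreFun_eq_iff_enlSolves`/`det_fibreMatrix_ne_zero_of_enl_injective`. -/
theorem hL'_of_strip [NeZero N] {κc : ℝ} (hκ1 : κc ≤ 1) (hD : 2 * D * κc ^ 2 < 4) {p : Fin D → ℂ} (hp : p ∈ Strip D κc) :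
    ∀ m : {m : TorusSite D N // m ≠ 0}, lapSym (kFine p m.1) ≠ 0 :=
  fun m => lapSym_kFine_ne_zero_of_strip hκ1 hD hp m.2

/-- [folklore] The `D = d + 1 = 4` instance: `κ = 1/2` works (`2·4·(1/4) = 2 < 4`). -/
theorem hL'_of_strip_half [NeZero N] {p : Fin 4 → ℂ} (hp : p ∈ Strip 4 (1 / 2)) :
    ∀ m : {m : TorusSite 4 N // m ≠ 0}, lapSym (kFine p m.1) ≠ 0 :=
  hL'_of_strip (by norm_num) (by norm_num) hp

end Summit.QuantumFields.BalabanUV.Beta.GAN24.GoodAliasStrip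

end
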